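import Mathlib
import Literature.Geometry.DiscreteGeometry.BondGraph
import Literature.MathematicalPhysics.StatisticalMechanics.BarlowStacking

/-!
# Charge-freeness at tolerance 1/100 is open at close-packed germs

Stub `stub_chargeFreeOpenAtGerm` of the line `frustration-free-census-germ` for the crux
`PricedLinkCensus.TruncatedCensusGap` (item stmt-AtomisticToContinuum-14230), registered by
`ledger skeleton check` on the skeleton `Cruxes/TruncatedCensusGap/Lines/frustration_free_census_germ.lean`.
The statement below is the registered signature VERBATIM (self-contained over tree declarations).

Given the window link geometry (hypothesis = registered stub `stub_barlowWindowLink`, do NOT prove it here), a site whose `3a`-neighbourhood is `a/2`-separated and two-way `δa`-matched to a rigid Barlow stacking (spacing within `1/250` of ideal) is charge-free at tolerance `1/100` for `δ = 1/1000`.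

## Proof layout

* `germ_*` lemmas: the abstract "matching dictionary" for a configuration `y : ι → X` in a
  pseudo-metric space, two-way `a/1000`-matched within `3a` of a root site `i` to a point set
  `T` which is `81a/100`-separated and whose near points (`< 7a/5`) of any centre lie at
  distance in `[0.9973a, 1.0027a]`: sites and points determine each other (`germ_point_unique`,
  `germ_site_unique`), nearest-neighbour distances of the root and of its shell are pinched in
  `[0.9953a, 1.0047a]` (`germ_le_nearestDist`), the bonds of the root are exactly the sites of
  the near points of the root point (`germ_neighborSet_root`) and the common bond-neighbours of
  a root bond are exactly the sites of the common near points (`germ_inter_neighborSet`);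
  whence `isChargeFree_of_germMatched`.
* `germ_window_bounds`: the spacing window `|c − a√(2/3)| ≤ a√(2/3)/250` forces
  `81a/100 ≤ c ≤ 17a/20` and `√(a²/3 + c²) ∈ [0.9973a, 1.0027a]`.
* `stub_chargeFreeOpenAtGerm`: pull the configuration back by the rigid motion `g` and apply
  the abstract theorem to `T = barlowStacking a c s`.
-/

noncomputable section

namespace Summit.AtomisticToContinuum.Crystallization.Theorems.PricedLinkCensusTruncatedCensusGap

open scoped BigOperators
open Literature.MathematicalPhysics.StatisticalMechanics Literature.Geometry.DiscreteGeometry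

section GermMatched

variable {ι X : Type*} [PseudoMetricSpace X] {y : ι → X} {i : ι} {T : Set X} {a : ℝ}
  {z₀ : X} {Z : ι → X} {J : X → ι}

/-- Two points of an `81a/100`-separated set within `a/1000` of a common point coincide.
[folklore] -/
theorem germ_point_unique (ha : 0 < a)
    (hT1 : ∀ z ∈ T, ∀ w ∈ T, z ≠ w → 81 / 100 * a ≤ dist z w)
    {p z w : X} (hz : z ∈ T) (hw : w ∈ T)
    (hpz : dist p z ≤ 1 / 1000 * a) (hpw : dist p w ≤ 1 / 1000 * a) : z = w := by
  by_contra hne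
  have h1 := hT1 z hz w hw hne
  have h2 := dist_triangle_left z w p
  linarith

/-- Two sites within `a/1000` of a common point, the first within `3a` of the root site, coincide
(by the `a/2`-separation near the root). [folklore] -/
theorem germ_site_unique (ha : 0 < a)
    (hsep : ∀ j k, j ≠ k → dist (y j) (y i) ≤ 3 * a → a / 2 ≤ dist (y j) (y k))
    {j k : ι} {p : X} (hj : dist (y j) (y i) ≤ 3 * a)
    (hjp : dist (y j) p ≤ 1 / 1000 * a) (hkp : dist (y k) p ≤ 1 / 1000 * a) : j = k := by
  by_contra hne
  have h1 := hsep j k hne hj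
  have h2 := dist_triangle_right (y j) (y k) p
  linarith

/-- A near point `z` of the root point `z₀` is matched by a site `J z` within `a/1000`; that site
lies within `1.0047a` of the root site and is not the root site. [folklore] -/
theorem germ_near_site (ha : 0 < a)
    (hT2 : ∀ z₀ ∈ T, ∀ z ∈ T, z ≠ z₀ → dist z z₀ < 7 / 5 * a →
      9973 / 10000 * a ≤ dist z z₀ ∧ dist z z₀ ≤ 10027 / 10000 * a)
    (hJ : ∀ z ∈ T, dist z (y i) ≤ 3 * a → dist (y (J z)) z ≤ 1 / 1000 * a)
    (hz₀ : z₀ ∈ T) (hiz₀ : dist (y i) z₀ ≤ 1 / 1000 * a)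
    {z : X} (hz : z ∈ T) (hne : z ≠ z₀) (hd : dist z z₀ < 7 / 5 * a) :
    dist (y (J z)) z ≤ 1 / 1000 * a ∧ dist (y (J z)) (y i) ≤ 10047 / 10000 * a ∧ i ≠ J z := by
  obtain ⟨hlo, hhi⟩ := hT2 z₀ hz₀ z hz hne hd
  have hzi := dist_triangle_right z (y i) z₀
  have hJz := hJ z hz (by linarith)
  refine ⟨hJz, ?_, ?_⟩
  · have := dist_triangle (y (J z)) z (y i)
    linarith
  · intro heq
    rw [← heq, dist_comm] at hJz
    have := dist_triangle_right z z₀ (y i)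
    rw [dist_comm z₀ (y i)] at this
    linarith

/-- Every other site is at distance `≥ 0.9953a` from a site within `1.0047a` of the root site.
[folklore] -/
theorem germ_le_dist (ha : 0 < a)
    (hT2 : ∀ z₀ ∈ T, ∀ z ∈ T, z ≠ z₀ → dist z z₀ < 7 / 5 * a →
      9973 / 10000 * a ≤ dist z z₀ ∧ dist z z₀ ≤ 10027 / 10000 * a)
    (hsep : ∀ j k, j ≠ k → dist (y j) (y i) ≤ 3 * a → a / 2 ≤ dist (y j) (y k))
    (hZ : ∀ j, dist (y j) (y i) ≤ 3 * a → Z j ∈ T ∧ dist (y j) (Z j) ≤ 1 / 1000 * a)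
    {j k : ι} (hj : dist (y j) (y i) ≤ 10047 / 10000 * a) (hkj : k ≠ j) :
    9953 / 10000 * a ≤ dist (y j) (y k) := by
  by_cases hk : dist (y k) (y i) ≤ 3 * a
  · obtain ⟨hZk, hdk⟩ := hZ k hk
    have hj3 : dist (y j) (y i) ≤ 3 * a := by linarith
    obtain ⟨hZj, hdj⟩ := hZ j hj3
    have hsjk := hsep j k hkj.symm hj3
    have hne : Z k ≠ Z j := by
      intro heq
      have h2 := dist_triangle_right (y j) (y k) (Z j)
      rw [heq] at hdk
      linarith
    have hlo : 9973 / 10000 * a ≤ dist (Z k) (Z j) := by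
      by_cases hd : dist (Z k) (Z j) < 7 / 5 * a
      · exact (hT2 (Z j) hZj (Z k) hZk hne hd).1
      · linarith [not_lt.1 hd]
    have h4 := dist_triangle4 (Z k) (y k) (y j) (Z j)
    rw [dist_comm (Z k) (y k), dist_comm (y k) (y j)] at h4
    linarith
  · push Not at hk
    have := dist_triangle (y k) (y j) (y i)
    rw [dist_comm (y k) (y j)] at this
    linarith

/-- Hence the nearest-neighbour distance of a site within `1.0047a` of the root site is
`≥ 0.9953a`. [folklore] -/
theorem germ_le_nearestDist (ha : 0 < a)
    (hT2 : ∀ z₀ ∈ T, ∀ z ∈ T, z ≠ z₀ → dist z z₀ < 7 / 5 * a →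
      9973 / 10000 * a ≤ dist z z₀ ∧ dist z z₀ ≤ 10027 / 10000 * a)
    (hsep : ∀ j k, j ≠ k → dist (y j) (y i) ≤ 3 * a → a / 2 ≤ dist (y j) (y k))
    (hZ : ∀ j, dist (y j) (y i) ≤ 3 * a → Z j ∈ T ∧ dist (y j) (Z j) ≤ 1 / 1000 * a)
    (hnt : ∀ j : ι, ∃ k, k ≠ j) {j : ι} (hj : dist (y j) (y i) ≤ 10047 / 10000 * a) :
    9953 / 10000 * a ≤ nearestDist y j :=
  le_nearestDist (hnt j) fun _ hk => germ_le_dist ha hT2 hsep hZ hj hk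

/-- **The bonds of the root site** are exactly the matched sites of the near points of the root
point. [folklore] -/
theorem germ_neighborSet_root (ha : 0 < a)
    (hT2 : ∀ z₀ ∈ T, ∀ z ∈ T, z ≠ z₀ → dist z z₀ < 7 / 5 * a →
      9973 / 10000 * a ≤ dist z z₀ ∧ dist z z₀ ≤ 10027 / 10000 * a)
    (hsep : ∀ j k, j ≠ k → dist (y j) (y i) ≤ 3 * a → a / 2 ≤ dist (y j) (y k))
    (hZ : ∀ j, dist (y j) (y i) ≤ 3 * a → Z j ∈ T ∧ dist (y j) (Z j) ≤ 1 / 1000 * a)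
    (hJ : ∀ z ∈ T, dist z (y i) ≤ 3 * a → dist (y (J z)) z ≤ 1 / 1000 * a)
    (hz₀ : z₀ ∈ T) (hiz₀ : dist (y i) z₀ ≤ 1 / 1000 * a) (hnt : ∀ j : ι, ∃ k, k ≠ j)
    (hnni : nearestDist y i ≤ 10047 / 10000 * a) :
    (bondGraph (1 / 100 : ℝ) y).neighborSet i =
      J '' {z ∈ T | z ≠ z₀ ∧ dist z z₀ < 7 / 5 * a} := by
  ext k
  rw [mem_neighborSet_bondGraph]
  constructor
  · rintro ⟨hik, hdk⟩
    have hmin := min_le_left (nearestDist y i) (nearestDist y k)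
    have hd : dist (y i) (y k) ≤ 1014747 / 1000000 * a := by nlinarith
    have hk3 : dist (y k) (y i) ≤ 3 * a := by rw [dist_comm]; linarith
    obtain ⟨hZk, hdZk⟩ := hZ k hk3
    have hne : Z k ≠ z₀ := by
      intro heq
      have h1 := hsep k i (Ne.symm hik) hk3
      have h2 := dist_triangle_right (y k) (y i) (Z k)
      rw [heq] at h2 hdZk
      linarith
    have hkz₀ := dist_triangle4 (Z k) (y k) (y i) z₀
    rw [dist_comm (Z k) (y k), dist_comm (y k) (y i)] at hkz₀
    refine ⟨Z k, ⟨hZk, hne, by linarith⟩, ?_⟩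
    have hZk3 : dist (Z k) (y i) ≤ 3 * a := by
      have := dist_triangle_left (Z k) (y i) (y k)
      rw [dist_comm (y k) (y i)] at this
      linarith
    exact (germ_site_unique ha hsep hk3 hdZk (hJ (Z k) hZk hZk3)).symm
  · rintro ⟨z, ⟨hz, hne, hd⟩, rfl⟩
    obtain ⟨-, hJzi, hiJ⟩ := germ_near_site ha hT2 hJ hz₀ hiz₀ hz hne hd
    refine ⟨hiJ, ?_⟩
    have h0 : dist (y i) (y i) ≤ 10047 / 10000 * a := by rw [dist_self]; positivity
    have h := le_min (germ_le_nearestDist ha hT2 hsep hZ hnt h0)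
      (germ_le_nearestDist ha hT2 hsep hZ hnt hJzi)
    rw [dist_comm] at hJzi
    linarith

/-- **The common bond-neighbours of a root bond** `{i, J z}` among the bonds of the root are
exactly the matched sites of the common near points of `z₀` and `z`. [folklore] -/
theorem germ_inter_neighborSet (ha : 0 < a)
    (hT1 : ∀ z ∈ T, ∀ w ∈ T, z ≠ w → 81 / 100 * a ≤ dist z w)
    (hT2 : ∀ z₀ ∈ T, ∀ z ∈ T, z ≠ z₀ → dist z z₀ < 7 / 5 * a →
      9973 / 10000 * a ≤ dist z z₀ ∧ dist z z₀ ≤ 10027 / 10000 * a)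
    (hsep : ∀ j k, j ≠ k → dist (y j) (y i) ≤ 3 * a → a / 2 ≤ dist (y j) (y k))
    (hZ : ∀ j, dist (y j) (y i) ≤ 3 * a → Z j ∈ T ∧ dist (y j) (Z j) ≤ 1 / 1000 * a)
    (hJ : ∀ z ∈ T, dist z (y i) ≤ 3 * a → dist (y (J z)) z ≤ 1 / 1000 * a)
    (hz₀ : z₀ ∈ T) (hiz₀ : dist (y i) z₀ ≤ 1 / 1000 * a) (hnt : ∀ j : ι, ∃ k, k ≠ j)
    {z : X} (hz : z ∈ T) (hne : z ≠ z₀) (hd : dist z z₀ < 7 / 5 * a) :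
    J '' {w ∈ T | w ≠ z₀ ∧ dist w z₀ < 7 / 5 * a} ∩ (bondGraph (1 / 100 : ℝ) y).neighborSet (J z) =
      J '' {w ∈ T | w ≠ z₀ ∧ w ≠ z ∧ dist w z₀ < 7 / 5 * a ∧ dist w z < 7 / 5 * a} := by
  obtain ⟨hJz, hJzi, hiJz⟩ := germ_near_site ha hT2 hJ hz₀ hiz₀ hz hne hd
  have hnn : nearestDist y (J z) ≤ 10047 / 10000 * a := (nearestDist_le_dist y hiJz).trans hJzi
  ext k
  simp only [Set.mem_inter_iff, Set.mem_image, Set.mem_setOf_eq, mem_neighborSet_bondGraph]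
  constructor
  · rintro ⟨⟨w, ⟨hw, hwne, hwd⟩, rfl⟩, hJzw, hdzw⟩
    obtain ⟨hJw, -, -⟩ := germ_near_site ha hT2 hJ hz₀ hiz₀ hw hwne hwd
    have hmin := min_le_left (nearestDist y (J z)) (nearestDist y (J w))
    have hdist : dist (y (J z)) (y (J w)) ≤ 1014747 / 1000000 * a := by nlinarith
    have h4 := dist_triangle4 w (y (J w)) (y (J z)) z
    rw [dist_comm w (y (J w)), dist_comm (y (J w)) (y (J z))] at h4
    exact ⟨w, ⟨hw, hwne, fun h => hJzw (by rw [h]), hwd, by linarith⟩, rfl⟩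
  · rintro ⟨w, ⟨hw, hwne, hwz, hwd, hwzd⟩, rfl⟩
    obtain ⟨hJw, hJwi, -⟩ := germ_near_site ha hT2 hJ hz₀ hiz₀ hw hwne hwd
    refine ⟨⟨w, ⟨hw, hwne, hwd⟩, rfl⟩, ?_, ?_⟩
    · intro heq
      rw [heq] at hJz
      exact hwz (germ_point_unique ha hT1 hw hz hJw hJz)
    · have hhi := (hT2 z hz w hw hwz hwzd).2
      have h4 := dist_triangle4 (y (J z)) z w (y (J w))
      rw [dist_comm z w, dist_comm w (y (J w))] at h4
      have h := le_min (germ_le_nearestDist ha hT2 hsep hZ hnt hJzi)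
        (germ_le_nearestDist ha hT2 hsep hZ hnt hJwi)
      linarith

/-- The matching `z ↦ J z` is injective on the points within `3a` of the root site. [folklore] -/
theorem germ_injOn (ha : 0 < a)
    (hT1 : ∀ z ∈ T, ∀ w ∈ T, z ≠ w → 81 / 100 * a ≤ dist z w)
    (hJ : ∀ z ∈ T, dist z (y i) ≤ 3 * a → dist (y (J z)) z ≤ 1 / 1000 * a) :
    Set.InjOn J {z ∈ T | dist z (y i) ≤ 3 * a} := by
  rintro z ⟨hz, hz3⟩ w ⟨hw, hw3⟩ heq
  have h1 := hJ z hz hz3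
  rw [heq] at h1
  exact germ_point_unique ha hT1 hz hw h1 (hJ w hw hw3)

/-- **Charge-freeness of a germ-matched site (abstract form).** If the `3a`-neighbourhood of the
site `i` is `a/2`-separated and two-way `a/1000`-matched to a point set `T` which is
`81a/100`-separated, whose near points (`< 7a/5`) of every centre are twelve, at distances in
`[0.9973a, 1.0027a]`, any two near points having exactly four common near points, then `i` is
charge-free at tolerance `1/100`. [folklore] -/
theorem isChargeFree_of_germMatched (ha : 0 < a)
    (hT1 : ∀ z ∈ T, ∀ w ∈ T, z ≠ w → 81 / 100 * a ≤ dist z w)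
    (hT2 : ∀ z₀ ∈ T, ∀ z ∈ T, z ≠ z₀ → dist z z₀ < 7 / 5 * a →
      9973 / 10000 * a ≤ dist z z₀ ∧ dist z z₀ ≤ 10027 / 10000 * a)
    (hT3 : ∀ z₀ ∈ T, {z ∈ T | z ≠ z₀ ∧ dist z z₀ < 7 / 5 * a}.ncard = 12)
    (hT4 : ∀ z₀ ∈ T, ∀ z ∈ T, z ≠ z₀ → dist z z₀ < 7 / 5 * a →
      {w ∈ T | w ≠ z₀ ∧ w ≠ z ∧ dist w z₀ < 7 / 5 * a ∧ dist w z < 7 / 5 * a}.ncard = 4)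
    (hsep : ∀ j k, j ≠ k → dist (y j) (y i) ≤ 3 * a → a / 2 ≤ dist (y j) (y k))
    (hM1 : ∀ j, dist (y j) (y i) ≤ 3 * a → ∃ z ∈ T, dist (y j) z ≤ 1 / 1000 * a)
    (hM2 : ∀ z ∈ T, dist z (y i) ≤ 3 * a → ∃ j, dist (y j) z ≤ 1 / 1000 * a) :
    IsChargeFree (1 / 100 : ℝ) y i := by
  haveI : Nonempty X := ⟨y i⟩
  haveI : Nonempty ι := ⟨i⟩
  choose! Z hZ using hM1
  choose! J hJ using hM2
  obtain ⟨hz₀, hiz₀⟩ := hZ i (by rw [dist_self]; positivity)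
  have h12 := hT3 (Z i) hz₀
  obtain ⟨z₁, hz₁, hne₁, hd₁⟩ := Set.nonempty_of_ncard_ne_zero
    (s := {z ∈ T | z ≠ Z i ∧ dist z (Z i) < 7 / 5 * a}) (by rw [h12]; norm_num)
  obtain ⟨-, hJz₁i, hiJ₁⟩ := germ_near_site ha hT2 hJ hz₀ hiz₀ hz₁ hne₁ hd₁
  have hnt : ∀ j : ι, ∃ k, k ≠ j := fun j => by
    by_cases h : j = i
    · subst h
      exact ⟨J z₁, hiJ₁.symm⟩
    · exact ⟨i, Ne.symm h⟩
  have hnni : nearestDist y i ≤ 10047 / 10000 * a :=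
    (nearestDist_le_dist y hiJ₁.symm).trans (by rw [dist_comm]; exact hJz₁i)
  have hN := germ_neighborSet_root ha hT2 hsep hZ hJ hz₀ hiz₀ hnt hnni
  have hinj := germ_injOn ha hT1 hJ
  have hsub : {z ∈ T | z ≠ Z i ∧ dist z (Z i) < 7 / 5 * a} ⊆ {z ∈ T | dist z (y i) ≤ 3 * a} := by
    rintro z ⟨hz, -, hd⟩
    have := dist_triangle_right z (y i) (Z i)
    exact ⟨hz, by linarith⟩
  refine ⟨?_, fun j hj => ?_⟩
  · rw [hN, (hinj.mono hsub).ncard_image, h12]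
  · rw [hN] at hj
    obtain ⟨z, ⟨hz, hne, hd⟩, rfl⟩ := hj
    rw [ringNumber_def, hN, germ_inter_neighborSet ha hT1 hT2 hsep hZ hJ hz₀ hiz₀ hnt hz hne hd,
      (hinj.mono ?_).ncard_image, hT4 (Z i) hz₀ z hz hne hd]
    rintro w ⟨hw, hwne, -, hwd, -⟩
    exact hsub ⟨hw, hwne, hwd⟩

end GermMatched

/-- **The spacing window in numbers**: `|c − a√(2/3)| ≤ a√(2/3)/250` forces
`81a/100 ≤ c ≤ 17a/20` and pins the interlayer near distance `√(a²/3 + c²)` in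
`[0.9973a, 1.0027a]`. [folklore] -/
theorem germ_window_bounds {a c : ℝ} (ha : 0 < a)
    (hc : |c - a * Real.sqrt (2 / 3)| ≤ a * Real.sqrt (2 / 3) / 250) :
    81 / 100 * a ≤ c ∧ c ≤ 17 / 20 * a ∧
      9973 / 10000 * a ≤ Real.sqrt (a ^ 2 / 3 + c ^ 2) ∧
      Real.sqrt (a ^ 2 / 3 + c ^ 2) ≤ 10027 / 10000 * a := by
  obtain ⟨h1, h2⟩ := abs_le.1 hc
  have hm0 : 0 ≤ a * Real.sqrt (2 / 3) := by positivity
  have hm2 : (a * Real.sqrt (2 / 3)) ^ 2 = 2 / 3 * a ^ 2 := by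
    rw [mul_pow, Real.sq_sqrt (by norm_num)]
    ring
  have hc0 : 0 ≤ c := by linarith
  have hcl : 249 / 250 * (a * Real.sqrt (2 / 3)) ≤ c := by linarith
  have hcu : c ≤ 251 / 250 * (a * Real.sqrt (2 / 3)) := by linarith
  have hc2l : (249 / 250 * (a * Real.sqrt (2 / 3))) ^ 2 ≤ c ^ 2 :=
    pow_le_pow_left₀ (by positivity) hcl 2
  have hc2u : c ^ 2 ≤ (251 / 250 * (a * Real.sqrt (2 / 3))) ^ 2 := pow_le_pow_left₀ hc0 hcu 2
  rw [mul_pow, hm2] at hc2l hc2u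
  refine ⟨?_, ?_, ?_, ?_⟩
  · nlinarith
  · nlinarith
  · rw [Real.le_sqrt' (by positivity)]
    nlinarith
  · rw [Real.sqrt_le_left (by positivity)]
    nlinarith

/-- **Charge-freeness is open at close-packed germs** (from the window link geometry): for some `δ ∈ (0, 1/2]`, every `δ`-germ-matched site (two-way `δa`-matching within `3a` to a rigid image of `barlowStacking a c s`, `a/2`-separation, spacing window `±1/250`) has twelve bonds with all ring numbers four in the scale-free bond graph at tolerance `1/100`. [folklore] -/
theorem stub_chargeFreeOpenAtGerm :
    (∀ (a c : ℝ) (s : ℤ → ℤ), 0 < a → 81 / 100 * a ≤ c → c ≤ 17 / 20 * a → IsHaggSeq s →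
      ∀ z₀ ∈ barlowStacking a c s,
        (∀ z ∈ barlowStacking a c s, z ≠ z₀ → dist z z₀ < 7 / 5 * a →
            dist z z₀ = a ∨ dist z z₀ = Real.sqrt (a ^ 2 / 3 + c ^ 2)) ∧
        {z ∈ barlowStacking a c s | z ≠ z₀ ∧ dist z z₀ < 7 / 5 * a}.ncard = 12 ∧
        (∀ z ∈ barlowStacking a c s, z ≠ z₀ → dist z z₀ < 7 / 5 * a →
            {w ∈ barlowStacking a c s | w ≠ z₀ ∧ w ≠ z ∧ dist w z₀ < 7 / 5 * a ∧
                dist w z < 7 / 5 * a}.ncard = 4)) →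
    ∃ δ : ℝ, 0 < δ ∧ δ ≤ 1 / 2 ∧
      ∀ (N : ℕ) (y : Fin N → EuclideanSpace ℝ (Fin 3)) (i : Fin N),
        (∃ (a c : ℝ) (s : ℤ → ℤ)
            (g : EuclideanSpace ℝ (Fin 3) ≃ᵃⁱ[ℝ] EuclideanSpace ℝ (Fin 3)),
          0 < a ∧ IsHaggSeq s ∧ |c - a * Real.sqrt (2 / 3)| ≤ a * Real.sqrt (2 / 3) / 250 ∧
          (∀ j k : Fin N, j ≠ k → dist (y j) (y i) ≤ 3 * a → a / 2 ≤ dist (y j) (y k)) ∧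
          (∀ j : Fin N, dist (y j) (y i) ≤ 3 * a →
              ∃ z ∈ barlowStacking a c s, dist (y j) (g z) ≤ δ * a) ∧
          (∀ z ∈ barlowStacking a c s, dist (g z) (y i) ≤ 3 * a →
              ∃ j : Fin N, dist (y j) (g z) ≤ δ * a)) →
        IsChargeFree (1 / 100 : ℝ) y i := by
  intro hW
  refine ⟨1 / 1000, by norm_num, by norm_num, ?_⟩
  rintro N y i ⟨a, c, s, g, ha, hs, hc, hsep, hM1, hM2⟩
  obtain ⟨hc1, hc2, hl1, hl2⟩ := germ_window_bounds ha hc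
  have hW' := hW a c s ha hc1 hc2 hs
  rw [← isChargeFree_comp_isometry_iff g.symm.isometry (1 / 100 : ℝ) y i]
  have hdyy : ∀ j k, dist ((⇑g.symm ∘ y) j) ((⇑g.symm ∘ y) k) = dist (y j) (y k) := fun j k =>
    g.symm.dist_map (y j) (y k)
  have hdyz : ∀ j z, dist ((⇑g.symm ∘ y) j) z = dist (y j) (g z) := fun j z => by
    rw [Function.comp_apply, ← g.symm.dist_map (y j) (g z), g.symm_apply_apply]
  refine isChargeFree_of_germMatched (T := barlowStacking a c s) ha ?_ ?_
    (fun z₀ hz₀ => (hW' z₀ hz₀).2.1) (fun z₀ hz₀ => (hW' z₀ hz₀).2.2) ?_ ?_ ?_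
  · intro z hz w hw hne
    have h1 := le_dist_of_mem_barlowStacking a c s ha.le (by linarith) hz hw hne
    have h2 : 81 / 100 * a ≤ min a c := le_min (by linarith) hc1
    linarith
  · intro z₀ hz₀ z hz hne hd
    rcases (hW' z₀ hz₀).1 z hz hne hd with h | h <;> rw [h]
    · constructor <;> linarith
    · exact ⟨hl1, hl2⟩
  · intro j k hjk hj
    rw [hdyy] at hj ⊢
    exact hsep j k hjk hj
  · intro j hj
    rw [hdyy] at hj
    obtain ⟨z, hz, hd⟩ := hM1 j hj
    exact ⟨z, hz, by rw [hdyz]; exact hd⟩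
  · intro z hz hd
    rw [dist_comm, hdyz, dist_comm] at hd
    obtain ⟨j, hj⟩ := hM2 z hz hd
    exact ⟨j, by rw [hdyz]; exact hj⟩

end Summit.AtomisticToContinuum.Crystallization.Theorems.PricedLinkCensusTruncatedCensusGap

end
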